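import Summits.BirchSwinnertonDyer.BirchSwinnertonDyer.Theorems.InertBadSignedBranchesCccOneLawOnTypeIstarZeroOfLowerHalf
import Summits.BirchSwinnertonDyer.BirchSwinnertonDyer.Theorems.InertBadSignedBranchesCccOneLawOnTypeIstarZeroOfEtaGZPair
import Summits.BirchSwinnertonDyer.Rank1Residual.X12.InertCoreInstancesH
import Summits.BirchSwinnertonDyer.Rank1Residual.X12.CongruentNumberOddPart
import HarnessLib

/-!
# Route `InertBadSignedBranches` (rung K8), crux `CccOneLawOnTypeIstarZero` (stmt-19223): the
# tribunal's BC5 / t3 WITNESS — the crux INSTANTIATED at the core pair `(E₂₃, 23)`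
# (`E₂₃ = 16928e1 : y² = x³ − 23²x`, CM by `ℤ[i]`, `23 ≡ 3 (mod 4)` inert, Kodaira `I₀*` at `23`)
# (helper `--supports` stmt-BirchSwinnertonDyer-19223; cell bsd-cm, seat bsd-cm-inert g12; nothing booked)

WHAT IS PROVED (kernel):

* §1 `hasSignedLocalType_c16928e1` — **UNCONDITIONAL**: the Cremona model `16928e1 = [0,0,0,−529,0]`
  (x1b's record curve `X12.Records.c16928e1`) IS a member of the crux's type at `p = 23`:
  `HasSignedLocalType c16928e1 23 I₀*` (CM, `23` inert in `ℚ(i)`, bad, Kodaira `I₀*` at the place over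
  `23`) — from the congruent-number lemma `X12.CongruentNumber.hasSignedLocalType_of_dvd` (`n = 23`
  squarefree, `23 ∣ 23`, `23 % 4 = 3`), the model being `congruentNumberCurve 23` on the nose.
* §2 `cccOneLaw_c16928e1_twentyThree` — **the witness (T-KR form)**: the crux's conclusion
  `Additive.QuadraticBranchPAdicGrossZagierValuationAt c16928e1 23` (C-cc-1 at the pair: for EVERY
  good `a_23 = 0` twin datum `(V, C, f, ϖ, L)` and every generator `P` of level `n`,
  `coeff₁ L ≠ 0 ∧ v_23(coeff₁ L) = 2n + ord_23(#Ш_an·Tam/#tors²)`) FROM the route's own support items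
  `PrintReadingsInert` (19226) / `PublishedFactsInert` (19227), the published facts of x1b's per-pair
  record `X12.bsdp_23_c16928e1` (Gross–Zagier, Kolyvagin, Matar–Nekovář Thm 0.3, Friedberg–Hoffstein,
  the CM rank-zero triple, Cremona's Manin sentences), and the lane's two certified data of the pair:
  `r_an(E₂₃) = 1` and `#Ш(E₂₃)_an = q` with `ord_23 q = 0` (Cremona: `#Ш_an = 1`). Mechanism: the record
  gives `BSD(E₂₃, 23)`; g11's `CccOneLowerHalf.quadraticBranchPAdicGrossZagierValuationAt_of_bsdp_of_readings`
  turns `BSD_p` + readings into C-cc-1 at the pair. NO `(GZ_η-VAL)` hypothesis, no `p`-adic analytic datum.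
* §3 `cccOneLaw_c16928e1_twentyThree'` — the same witness through the every-curve upper half (g11 §5,
  `quadraticBranchPAdicGrossZagierValuationAt_of_shaAn_unit_of_seven_lt` at `p = 23 > 7`; Edixhoven /
  Deuring / Cassels in place of Cremona's Manin sentences).
* §4 `cccOneLawOnTypeIstarZero_c16928e1_twentyThree` — the witness in the EXACT SHAPE of the crux body
  `5 ≤ 23 → HasSignedLocalType c16928e1 23 I₀* → r_an = 1 → C-cc-1` (the `p = 23`, `W = E₂₃` instance of
  `CccOneLawOnTypeIstarZero`, its two inner binders consumed), modulo the same items/facts/datum.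
* §5 `etaGZValuationAt_c16928e1_twentyThree` — corollary: (GZ_η-VAL) at the pair in print currency
  (`v_23(coeff₁ L⁻_23(V,η,X)) = 2·v_23(log_ω P) + ord_23(L′(E₂₃,1)/(Ω·Reg))`) by g10's pair converse
  `EtaGZ.etaGZValuationAt_of_quadraticBranchPAdicGrossZagierValuationAt`.

HONEST LABEL (tribunal t3 / BC5, referee): this is a RELATIVE witness — the crux instance at one member
of the type is derived from published theorems (named-fact hypotheses, displayed), the route's support
items 19226/19227 (hypotheses `h₅ h₆`, 19226 being conjecture-grade by design, D73), and two certified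
per-pair data (hypotheses `hr`, `hq`/`hv`); exactly as K7r's `stub_ellipticUnitIndexSeven_D11`. It shows
the crux is CONSISTENT with — indeed forced by — the known `BSD(E₂₃, 23)`; it carries no `p`-adic
`L`-function content beyond the readings (g11 §4: at `p ≥ 11` the crux IS the lower half on the type).
What this is NOT: not a proof of the crux at class level; not (GZ_η-VAL) as an analytic theorem; no new
typed input, no Literature statement, no named fact minted; nothing booked; no label moves; 19223 OPEN.
[cite: Cremona1997, Table 1 (curve 16928e1) and Table 4 (BSD data)] [cite: MatarNekovar2019, Thm. 0.3 and §0.11]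
[cite: Kobayashi2003, §4 (p. 8), Thm. 7.4 (p. 13)] [cite: SilvermanATAEC1994, IV.9.4 Table 4.1]
[cite: Miller2011LMS, §1 and Def. 1.1]
-/

set_option autoImplicit false
set_option linter.dupNamespace false

noncomputable section

open scoped Classical MatrixGroups ModularForm NumberField

open CongruenceSubgroup Field WeierstrassCurve NumberField IsDedekindDomain
open Literature.NumberTheory.EllipticCurves
open Literature.NumberTheory.EllipticCurves.ModularForms
open Literature.NumberTheory.EllipticCurves.Kobayashi2003 hiding IsQuadraticBranchMinusLFunction
open Literature.NumberTheory.EllipticCurves.Rank1Residual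
open Literature.NumberTheory.EllipticCurves.Rank1Residual.Typed
open Literature.NumberTheory.EllipticCurves.AgasheRibetStein2006
open Literature.NumberTheory.GaloisRepresentations Literature.NumberTheory.GaloisCohomology
open Summit.BirchSwinnertonDyer.Rank1Residual
open Summit.BirchSwinnertonDyer.Rank1Residual.Additive
open Summit.BirchSwinnertonDyer.Rank1Residual.Additive.LocalLog
open Summit.BirchSwinnertonDyer.Rank1Residual.X12
open Summit.BirchSwinnertonDyer.Rank1Residual.X12.O10
open Summit.BirchSwinnertonDyer.BirchSwinnertonDyer.Theorems.CccOneLowerHalf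
open Summit.BirchSwinnertonDyer.BirchSwinnertonDyer.Theorems.EtaGZ

namespace Summit.BirchSwinnertonDyer.BirchSwinnertonDyer.Theorems.CccOneWitness

section Witness

/-! ## §1 The member: `E₂₃ = 16928e1` has signed local type `(23, I₀*)` — unconditional -/

/-- x1b's record model `16928e1 = [0, 0, 0, −529, 0]` IS the congruent-number curve `E₂₃` (`−529 = −23²`).
[cite: Cremona1997, Table 1 (curve 16928e1)] -/
theorem c16928e1_eq_congruentNumberCurve : Records.c16928e1 = congruentNumberCurve 23 := by
  simp only [Records.c16928e1, congruentNumberCurve]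
  norm_num

/-- … hence a model of `E₂₃` in the sense of `X12.CongruentNumber` (identity change of variables).
[cite: Cremona1997, Table 1 (curve 16928e1)] -/
theorem exists_variableChange_c16928e1 :
    ∃ C : VariableChange ℚ, C • Records.c16928e1 = congruentNumberCurve 23 :=
  ⟨1, by rw [one_smul, c16928e1_eq_congruentNumberCurve]⟩

/-! Every statement below carries the binder `[Fact (Nat.Prime 23)]` (no global instance is declared;
a consumer supplies it by `haveI : Fact (Nat.Prime 23) := ⟨by norm_num⟩`). -/
variable [Fact (Nat.Prime 23)]

/-- **`E₂₃ = 16928e1` has signed local type `(23, I₀*)`** — CM by `ℤ[i]`, `23 ≡ 3 (mod 4)` INERT in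
`ℚ(i)`, bad at `23`, Kodaira symbol `I₀*` at the place over `23` (`E₂₃ = E₁^{(23)}`, `ord_{23} 23 = 1`,
Tate's algorithm Step 6): a MEMBER of the crux's type. UNCONDITIONAL (kernel).
[cite: SilvermanATAEC1994, IV.9.4 Step 6 and Table 4.1] [cite: Cox2013, §5.B Prop. 5.16 and Cor. 5.17] -/
theorem hasSignedLocalType_c16928e1 : HasSignedLocalType Records.c16928e1 23 (.Istar 0) :=
  CongruentNumber.hasSignedLocalType_of_dvd (n := 23) (Nat.prime_iff.mp (by norm_num)).squarefree
    exists_variableChange_c16928e1 (by norm_num) (dvd_refl 23) (by norm_num)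

/-! ## §2 THE WITNESS (T-KR form): C-cc-1 at `(E₂₃, 23)` from the route's support items, the published
facts of x1b's per-pair record, and the pair's two certified data -/

/-- **BC5 / t3 WITNESS for `CccOneLawOnTypeIstarZero`: C-cc-1 HOLDS at the core pair `(E₂₃, 23)`** —
`Additive.QuadraticBranchPAdicGrossZagierValuationAt 16928e1 23` — GIVEN the route's support items
`PrintReadingsInert` (`h₅`, item 19226: (C1_η) on the CM good-inert twins, (R2) and the exact
Kobayashi-7.4 reading on the type) and `PublishedFactsInert` (`h₆`, item 19227), the published facts of
x1b's record `X12.bsdp_23_c16928e1` (Gross–Zagier `hGZ`, Kolyvagin `hKo`, Matar–Nekovář Thm 0.3 `hMN`,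
Friedberg–Hoffstein `hFH`, the CM rank-zero triple `hCM8`, Cremona's Manin sentences `h26`/`h52`), and the
certified data `r_an(E₂₃) = 1` (`hr`) and `#Ш(E₂₃)_an = q`, `ord_{23} q = 0` (`hq`, `hv`; Cremona:
`#Ш_an = 1`). Proof: the record gives `BSD(E₂₃, 23)`; the readings at the member (§1) turn it into
C-cc-1 at the pair (`CccOneLowerHalf.quadraticBranchPAdicGrossZagierValuationAt_of_bsdp_of_readings`).
RELATIVE witness; CONDITIONAL on every displayed hypothesis; nothing booked; 19223 stays OPEN.
[cite: Cremona1997, Table 4 (curve 16928e1: r = 1, #Ш_an = 1)] [cite: MatarNekovar2019, Thm. 0.3 and §0.11]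
[cite: Kobayashi2003, §4 (p. 8), Thm. 7.4 (p. 13)] [cite: Miller2011LMS, §1 and Def. 1.1] -/
theorem cccOneLaw_c16928e1_twentyThree
    (h₅ : Summit.BirchSwinnertonDyer.BirchSwinnertonDyer.Theses.InertBadSignedBranches.PrintReadingsInert)
    (h₆ : Summit.BirchSwinnertonDyer.BirchSwinnertonDyer.Theses.InertBadSignedBranches.PublishedFactsInert)
    (hGZ : ∀ (N : ℕ) [NeZero N] (W : WeierstrassCurve ℚ) (K : Type) [Field K] [NumberField K],
      gross_zagier N W K)
    (hKo : ∀ (N : ℕ) [NeZero N] (W : WeierstrassCurve ℚ) (K : Type) [Field K] [NumberField K],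
      kolyvagin N W K)
    (hMN : ∀ (N : ℕ) [NeZero N] (W : WeierstrassCurve ℚ) (K : Type) [Field K] [NumberField K],
      MatarNekovar2019.thm03_padicValNat_card_sha_le_of_irreducible N W K)
    (hFH : friedbergHoffstein_exists_heegnerField_split_twist_ne_zero)
    (hCM8 : bsdTriple_of_hasCM_of_L_one_ne_zero)
    (h26 : cremona_abs_maninConstant_eq_one_of_level_le) (h52 : cremona_optimal_curveOne_x12Core)
    (hr : Records.c16928e1.analyticRank = 1)
    {q : ℚ} (hq : shaAn Records.c16928e1 = (q : ℂ)) (hv : padicValRat 23 q = 0) :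
    QuadraticBranchPAdicGrossZagierValuationAt Records.c16928e1 23 := by
  obtain ⟨hmod, -, hGZK, hPT, hnf, -⟩ := h₆
  obtain ⟨hC1, hRd⟩ := h₅ 23 (by norm_num)
  obtain ⟨hR2, h74x⟩ := hRd Records.c16928e1 hasSignedLocalType_c16928e1 hr
  have hB : BSDp Records.c16928e1 23 :=
    bsdp_23_c16928e1 hGZ hKo hMN hGZK hmod hnf hFH hCM8 h26 h52 hr hq hv
  refine quadraticBranchPAdicGrossZagierValuationAt_of_bsdp_of_readings Records.c16928e1 23 hmod hGZK
    hPT hB hR2 h74x fun V _ _ C hC hgood hap ↦ ?_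
  obtain ⟨hCM, hin⟩ := hasCM_and_cmInert_of_twist Records.c16928e1 23 hasSignedLocalType_c16928e1 C hC
  exact hC1 V hCM hgood hin

/-! ## §3 The same witness through the every-curve upper half (g11 §5 at `p = 23`) -/

/-- **The witness, every-curve form**: C-cc-1 at `(E₂₃, 23)` from `PrintReadingsInert`,
`PublishedFactsInert`, the eleven published facts of the every-curve upper half on the inert core
(Edixhoven / Deuring / Cassels in place of Cremona's sentences), and the two certified data — the
`p = 23 > 7` instance of `CccOneLowerHalf.quadraticBranchPAdicGrossZagierValuationAt_of_shaAn_unit_of_seven_lt`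
at the member of §1. RELATIVE witness; CONDITIONAL; nothing booked.
[cite: MatarNekovar2019, Thm. 0.3 and §0.11] [cite: EdixhovenManin1991, Thm. 3] [cite: Miller2011LMS, §1 and Def. 1.1] -/
theorem cccOneLaw_c16928e1_twentyThree'
    (h₅ : Summit.BirchSwinnertonDyer.BirchSwinnertonDyer.Theses.InertBadSignedBranches.PrintReadingsInert)
    (h₆ : Summit.BirchSwinnertonDyer.BirchSwinnertonDyer.Theses.InertBadSignedBranches.PublishedFactsInert)
    (hGZ : ∀ (N : ℕ) [NeZero N] (W : WeierstrassCurve ℚ) (K : Type) [Field K] [NumberField K],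
      gross_zagier N W K)
    (hKo : ∀ (N : ℕ) [NeZero N] (W : WeierstrassCurve ℚ) (K : Type) [Field K] [NumberField K],
      kolyvagin N W K)
    (hMN : ∀ (N : ℕ) [NeZero N] (W : WeierstrassCurve ℚ) (K : Type) [Field K] [NumberField K],
      MatarNekovar2019.thm03_padicValNat_card_sha_le_of_irreducible N W K)
    (hFH : friedbergHoffstein_exists_heegnerField_split_twist_ne_zero)
    (hCM8 : bsdTriple_of_hasCM_of_L_one_ne_zero)
    (hEdx : edixhoven_not_dvd_maninConstant_of_not_potentiallyGoodOrdinary)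
    (hDeu : deuring_not_hasUnitRootAt_of_hasCM_of_not_cmSplit) (hCassels : bsdRHS_eq_of_isIsogenous)
    (hr : Records.c16928e1.analyticRank = 1)
    {q : ℚ} (hq : shaAn Records.c16928e1 = (q : ℂ)) (hv : padicValRat 23 q = 0) :
    QuadraticBranchPAdicGrossZagierValuationAt Records.c16928e1 23 :=
  quadraticBranchPAdicGrossZagierValuationAt_of_shaAn_unit_of_seven_lt Records.c16928e1 23 h₅ h₆ hGZ
    hKo hMN hFH hCM8 hEdx hDeu hCassels (by norm_num) hasSignedLocalType_c16928e1 hr hq hv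

/-! ## §4 The witness in the exact shape of the crux body at `(p, W) = (23, E₂₃)` -/

/-- **The `(23, E₂₃)` INSTANCE of `CccOneLawOnTypeIstarZero`** — its body
`5 ≤ p → HasSignedLocalType W p I₀* → W.analyticRank = 1 → QuadraticBranchPAdicGrossZagierValuationAt W p`
at `p = 23`, `W = 16928e1`, with the two outer binders consumed and the inner ones kept — modulo the
route's support items, the record's published facts, and the certified `#Ш_an` datum. So the crux is
SATISFIED at a member of its type relative to print + items + data (BC5 / t3). CONDITIONAL; nothing booked.
[cite: Cremona1997, Table 4 (curve 16928e1)] [cite: MatarNekovar2019, Thm. 0.3 and §0.11] [cite: Miller2011LMS, §1 and Def. 1.1] -/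
theorem cccOneLawOnTypeIstarZero_c16928e1_twentyThree
    (h₅ : Summit.BirchSwinnertonDyer.BirchSwinnertonDyer.Theses.InertBadSignedBranches.PrintReadingsInert)
    (h₆ : Summit.BirchSwinnertonDyer.BirchSwinnertonDyer.Theses.InertBadSignedBranches.PublishedFactsInert)
    (hGZ : ∀ (N : ℕ) [NeZero N] (W : WeierstrassCurve ℚ) (K : Type) [Field K] [NumberField K],
      gross_zagier N W K)
    (hKo : ∀ (N : ℕ) [NeZero N] (W : WeierstrassCurve ℚ) (K : Type) [Field K] [NumberField K],
      kolyvagin N W K)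
    (hMN : ∀ (N : ℕ) [NeZero N] (W : WeierstrassCurve ℚ) (K : Type) [Field K] [NumberField K],
      MatarNekovar2019.thm03_padicValNat_card_sha_le_of_irreducible N W K)
    (hFH : friedbergHoffstein_exists_heegnerField_split_twist_ne_zero)
    (hCM8 : bsdTriple_of_hasCM_of_L_one_ne_zero)
    (h26 : cremona_abs_maninConstant_eq_one_of_level_le) (h52 : cremona_optimal_curveOne_x12Core)
    {q : ℚ} (hq : shaAn Records.c16928e1 = (q : ℂ)) (hv : padicValRat 23 q = 0) :
    5 ≤ 23 → HasSignedLocalType Records.c16928e1 23 (.Istar 0) → Records.c16928e1.analyticRank = 1 →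
      QuadraticBranchPAdicGrossZagierValuationAt Records.c16928e1 23 :=
  fun _ _ hr ↦ cccOneLaw_c16928e1_twentyThree h₅ h₆ hGZ hKo hMN hFH hCM8 h26 h52 hr hq hv

/-! ## §5 Corollary: (GZ_η-VAL) at the pair, in print currency -/

/-- **(GZ_η-VAL) at `(E₂₃, 23)`**: for every good `a_{23} = 0` twin datum `(V, C, f, ϖ, L)` of `E₂₃`,
every generator `P` of `E₂₃(ℚ)/tors` and every `q′` with `L′(E₂₃,1)/(Ω·Reg) = q′`:
`coeff₁ L ≠ 0 ∧ v_{23}(coeff₁ L) = 2·v_{23}(log_ω P) + ord_{23} q′` — g10's pair converse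
`EtaGZ.etaGZValuationAt_of_quadraticBranchPAdicGrossZagierValuationAt` applied to §2. Same hypotheses;
RELATIVE; nothing booked. [cite: Kobayashi2003, §3 (3.5)–(3.7) (p. 7), §4 (p. 8)]
[cite: SilvermanAEC2009, IV.6.4 and VII.6.3] [cite: Miller2011LMS, §1 and Def. 1.1] -/
theorem etaGZValuationAt_c16928e1_twentyThree
    (h₅ : Summit.BirchSwinnertonDyer.BirchSwinnertonDyer.Theses.InertBadSignedBranches.PrintReadingsInert)
    (h₆ : Summit.BirchSwinnertonDyer.BirchSwinnertonDyer.Theses.InertBadSignedBranches.PublishedFactsInert)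
    (hGZ : ∀ (N : ℕ) [NeZero N] (W : WeierstrassCurve ℚ) (K : Type) [Field K] [NumberField K],
      gross_zagier N W K)
    (hKo : ∀ (N : ℕ) [NeZero N] (W : WeierstrassCurve ℚ) (K : Type) [Field K] [NumberField K],
      kolyvagin N W K)
    (hMN : ∀ (N : ℕ) [NeZero N] (W : WeierstrassCurve ℚ) (K : Type) [Field K] [NumberField K],
      MatarNekovar2019.thm03_padicValNat_card_sha_le_of_irreducible N W K)
    (hFH : friedbergHoffstein_exists_heegnerField_split_twist_ne_zero)
    (hCM8 : bsdTriple_of_hasCM_of_L_one_ne_zero)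
    (h26 : cremona_abs_maninConstant_eq_one_of_level_le) (h52 : cremona_optimal_curveOne_x12Core)
    (hr : Records.c16928e1.analyticRank = 1)
    {q : ℚ} (hq : shaAn Records.c16928e1 = (q : ℂ)) (hv : padicValRat 23 q = 0)
    (V : WeierstrassCurve ℚ) [V.IsElliptic] [V.IsGloballyMinimal] (C : VariableChange ℚ)
    {N : ℕ} [NeZero N] {f : CuspForm (Gamma0 N) 2}
    (hCV : C • Records.c16928e1.quadraticTwist ((-1) ^ (23 / 2) * 23) = V)
    (hgood : V.HasGoodReductionAtPrime 23) (hap : V.frobeniusTrace 23 = 0) (hf : IsNewformOf V f)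
    (ϖ : ℚ) (hϖ : if Even (23 / 2) then (ϖ : ℝ) * V.realPeriodRat = plusPeriod f
        else (ϖ : ℝ) * V.imaginaryPeriodRat = minusPeriod f)
    (L : IwasawaAlgebra 23) (hL : IsQuadraticBranchMinusLFunction f 23 ϖ L)
    (P : Records.c16928e1.toAffine.Point) (hP : ¬ IsOfFinAddOrder P)
    (hgen : ∀ R : Records.c16928e1.toAffine.Point, ∃ (k : ℤ) (T : Records.c16928e1.toAffine.Point),
      IsOfFinAddOrder T ∧ R = k • P + T)
    (q' : ℚ) (hq' : Records.c16928e1.leadingLCoeff /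
      ((Records.c16928e1.realPeriodRat * Records.c16928e1.regulator : ℝ) : ℂ) = (q' : ℂ)) :
    PowerSeries.coeff 1 L ≠ 0 ∧
      ((PowerSeries.coeff 1 L : ℤ_[23]) : ℚ_[23]).valuation =
        2 * (padicLog (Records.c16928e1.baseChange ℚ_[23]) (Records.c16928e1.toPadicPoint 23 P)).valuation +
          padicValRat 23 q' :=
  etaGZValuationAt_of_quadraticBranchPAdicGrossZagierValuationAt Records.c16928e1 23 (by norm_num)
    hasSignedLocalType_c16928e1 hr
    (cccOneLaw_c16928e1_twentyThree h₅ h₆ hGZ hKo hMN hFH hCM8 h26 h52 hr hq hv)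
    V C hCV hgood hap hf ϖ hϖ L hL P hP hgen q' hq'

end Witness

end Summit.BirchSwinnertonDyer.BirchSwinnertonDyer.Theorems.CccOneWitness

end
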